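import Mathlib
import Summits.KontsevichZagierPeriods.Zeta5Search.LongClassDecide52
import Summits.KontsevichZagierPeriods.Zeta5Search.SecondOrderLive
import Summits.KontsevichZagierPeriods.Zeta5Search.RecordCellAAtlas
import HarnessLib

/-!
# ζ(5) search — long classes of the record ray III: carries (kit for the structure theorem of the window `M = 52`)

Cell `pub-zeta5` (HONEST FRAMING: systematic search; no irrationality claim unless certified), typer seat generation 13.
For `n < p ≤ 25n/24` (`δ = p − n`, `24δ ≤ n`) and a residue `x < p`, the levels of the class of `x` in `b(n)` are
`x + kp = (k + c_k)·n + r_k` with the CARRIES `c_k = ⌊(x + kδ)/n⌋`: non-decreasing, steps `≤ 1`, `c_{k+24} ≤ c_k + 1`, `c₀ ≤ 1`,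
`c_{L+1} ≤ 2`.  Hence `c_k = c₀ + [k ≥ k₁] + [k ≥ k₂]` with the jump levels `k₁ ≤ k₂` (`Nat.find`), exact multiples of `n` occur
only at jump levels, the even centre at most once; together with `netExp_bRec_eq` this identifies the type list of the class with
`F52` of a coded tuple and proves the constraints `N52` (`longClass52`, file `LongClassStructure52`; here: the carry lemmas,
`brVal_flag_irrel`, the introduction rule `N52_intro`).  Integer bookkeeping; nothing here bears on irrationality.
-/

namespace Summit.KontsevichZagierPeriods.Zeta5Search.LongClass

open Finset
open Summit.KontsevichZagierPeriods.Zeta5Search.ClusterValuation (netExp bRec CentreIn)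
open Summit.KontsevichZagierPeriods.Zeta5Search.SecondOrder (topLevel classTypeList classTypeList_level level_bounds')
open Summit.KontsevichZagierPeriods.Zeta5Search.CellKit

variable {p : ℕ} [hp : Fact p.Prime]

/-! ## §1 Carries -/

/-- The carry sequence `c_k = ⌊(x + kδ)/n⌋`. -/
def carry (n δ x k : ℕ) : ℕ := (x + k * δ) / n

/-- The remainder sequence `r_k = (x + kδ) mod n`. -/
def rem (n δ x k : ℕ) : ℕ := (x + k * δ) % n

omit hp in
/-- **Levels in bracket form**: `x + k(n + δ) = (k + c_k)·n + r_k`. -/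
theorem level_eq (n δ x k : ℕ) : x + k * (n + δ) = (k + carry n δ x k) * n + rem n δ x k := by
  have h := Nat.div_add_mod (x + k * δ) n
  unfold carry rem
  calc x + k * (n + δ) = x + k * δ + k * n := by ring
    _ = n * ((x + k * δ) / n) + (x + k * δ) % n + k * n := by rw [h]
    _ = _ := by ring

omit hp in
/-- The bracket and the remainder of a level. -/
theorem level_div_mod {n : ℕ} (hn : 0 < n) (δ x k : ℕ) :
    (x + k * (n + δ)) / n = k + carry n δ x k ∧ (x + k * (n + δ)) % n = rem n δ x k := by
  have hr : rem n δ x k < n := Nat.mod_lt _ hn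
  rw [level_eq, Nat.add_comm]
  exact ⟨by rw [Nat.add_mul_div_right _ _ hn, Nat.div_eq_of_lt hr, zero_add],
    by rw [Nat.add_mul_mod_self_right, Nat.mod_eq_of_lt hr]⟩

omit hp in
/-- Carries are monotone. -/
theorem carry_mono (n δ x : ℕ) {k k' : ℕ} (h : k ≤ k') : carry n δ x k ≤ carry n δ x k' := by
  unfold carry; exact Nat.div_le_div_right (by nlinarith [Nat.mul_le_mul_right δ h])

omit hp in
/-- Carries grow by at most `1` over `m` steps when `mδ ≤ n`. -/
theorem carry_add_le {n δ x : ℕ} (hn : 0 < n) {m : ℕ} (hm : m * δ ≤ n) (k : ℕ) :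
    carry n δ x (k + m) ≤ carry n δ x k + 1 := by
  unfold carry
  calc (x + (k + m) * δ) / n ≤ (x + k * δ + n) / n := Nat.div_le_div_right (by nlinarith)
    _ = (x + k * δ) / n + 1 := Nat.add_div_right _ hn

omit hp in
/-- An exact multiple at level `k ≥ 1` is a jump level. -/
theorem carry_jump_of_rem_zero {n δ x : ℕ} (hδ1 : 1 ≤ δ) (hδn : δ ≤ n) {k : ℕ} (hk : 1 ≤ k)
    (hr : rem n δ x k = 0) : carry n δ x (k - 1) + 1 = carry n δ x k := by
  obtain ⟨j, rfl⟩ : ∃ j, k = j + 1 := ⟨k - 1, by omega⟩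
  rw [Nat.add_sub_cancel]
  unfold rem at hr
  unfold carry
  have h := Nat.div_add_mod (x + (j + 1) * δ) n
  rw [hr, add_zero] at h
  generalize hcg : (x + (j + 1) * δ) / n = c at h ⊢
  have hmul : (j + 1) * δ = j * δ + δ := by ring
  have hP : c * n = x + j * δ + δ := by rw [mul_comm]; omega
  have hc1 : 1 ≤ c := by
    by_contra h0
    have h00 : c = 0 := by omega
    rw [h00, zero_mul] at hP; omega
  have hsub : (c - 1) * n = c * n - n := Nat.sub_one_mul c n
  rw [Nat.div_eq_of_lt_le (k := c - 1) (by rw [hsub]; omega) (by rw [Nat.sub_add_cancel hc1]; omega)]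
  exact Nat.sub_add_cancel hc1

/-- Below bracket `24` the multiple-of-`n` flag is irrelevant. -/
theorem brVal_flag_irrel {β : ℕ} (h : β ≤ 23) (a a' : Bool) : brVal β a = brVal β a' := by
  unfold brVal; split_ifs <;> rfl

/-- **Introduction rule for the constraints `N52`.** -/
theorem N52_intro (t : Tup) (h0 : t.c0 ≤ 1) (hb : t.k2 ≤ t.L → t.k1 ≤ t.L) (hc : t.k1 ≤ t.L → 1 ≤ t.k1)
    (hd : t.k2 ≤ t.L → t.k1 + 24 ≤ t.k2) (he : t.c0 = 1 → t.k1 ≤ t.L → 24 ≤ t.k1)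
    (hf : t.L + t.carry t.L ≤ 41) (hg : 39 ≤ t.L + t.carry t.L)
    (hh : t.L + t.carry t.L = 41 → (t.k2 = t.L ∧ t.e2 = true) ∨ (t.k1 = t.L ∧ t.e1 = true ∧ ¬ t.k2 ≤ t.L))
    (hi : t.L + t.carry t.L = 39 →
      t.carry t.L ≤ 1 ∧ (t.k2 ≤ t.L → t.k2 + 23 ≤ t.L) ∧ (¬ t.k2 ≤ t.L → t.k1 ≤ t.L → t.k1 + 23 ≤ t.L))
    (hj : t.kap ≤ t.L → t.kap + t.carry t.kap = 20) (hk : t.e1 = true → t.k1 ≤ t.L) (hl : t.e2 = true → t.k2 ≤ t.L) :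
    N52 t = true := by
  have hcar : t.c0 + (if t.k1 ≤ t.L then 1 else 0) + (if t.k2 ≤ t.L then 1 else 0) = t.carry t.L := rfl
  unfold N52
  simp only [hcar, Bool.and_eq_true, Bool.or_eq_true, Bool.not_eq_true', decide_eq_true_eq, decide_eq_false_iff_not]
  refine ⟨⟨⟨⟨⟨⟨⟨⟨⟨⟨⟨h0, ?_⟩, ?_⟩, ?_⟩, ?_⟩, hf⟩, hg⟩, ?_⟩, ?_⟩, ?_⟩, ?_⟩, ?_⟩
  · exact (em (t.k2 ≤ t.L)).elim (fun h => Or.inr (hb h)) Or.inl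
  · exact (em (t.k1 ≤ t.L)).elim (fun h => Or.inr (hc h)) Or.inl
  · exact (em (t.k2 ≤ t.L)).elim (fun h => Or.inr (hd h)) Or.inl
  · by_cases h1 : t.c0 = 1
    · by_cases h2 : t.k1 ≤ t.L
      · exact Or.inr (he h1 h2)
      · exact Or.inl (by simp [h2])
    · exact Or.inl (by simp [h1])
  · by_cases h41 : t.L + t.carry t.L = 41
    · refine Or.inr ?_
      rcases hh h41 with ⟨h1, h2⟩ | ⟨h1, h2, h3⟩
      · exact Or.inl ⟨h1, h2⟩
      · exact Or.inr ⟨⟨h1, h2⟩, h3⟩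
    · exact Or.inl h41
  · by_cases h39 : t.L + t.carry t.L = 39
    · refine Or.inr ⟨(hi h39).1, ?_⟩
      by_cases h2 : t.k2 ≤ t.L
      · simp only [h2, if_true, decide_eq_true_eq]; exact (hi h39).2.1 h2
      · by_cases h1 : t.k1 ≤ t.L
        · simp only [h2, h1, if_true, if_false, decide_eq_true_eq]; exact (hi h39).2.2 h2 h1
        · simp only [h2, h1, if_false]
    · exact Or.inl h39
  · exact (em (t.kap ≤ t.L)).elim (fun h => Or.inr (hj h)) Or.inl
  · by_cases h : t.e1 = true
    · exact Or.inr (hk h)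
    · exact Or.inl (by simpa using h)
  · by_cases h : t.e2 = true
    · exact Or.inr (hl h)
    · exact Or.inl (by simpa using h)

/-! ## §2 The window and the class -/

end Summit.KontsevichZagierPeriods.Zeta5Search.LongClass
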